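import Summits.BirchSwinnertonDyer.BirchSwinnertonDyer.Theorems.KatoDescentTamePotSupersingularJetchevIrreducibleCebotarevImage
import HarnessLib

/-!
# Crux `JetchevIrreducibleReadingByName` (item 20165): the CORRECTED irreducible reading h32I′ of
# McCallum 1991 Cor. 3.2 (Kolyvagin primes with prescribed local orders of independent eigenclasses,
# `E[p]` IRREDUCIBLE, `K` Heegner for `N_E`, `p ∣ N_E`) — A THEOREM for every odd `p`; seat
# `bsd-potss-k8t-c4` g9; route-free; `--supports 20165`, helper; nothing booked, no item closed, BSD is
# not proved by this

Assembly of `…CebotarevPrimes.cor32_pow_of_image` (Cor. 3.2 for any image with (Z), (S), (C)) with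
`…CebotarevImage` ((Z), (S), (C) over `K` from `W.HasIrreducibleModPGaloisRep p` and
`ρ̄(Γ_K) = ρ̄(Γ_ℚ)`, the latter from `K` unramified at `p` and at the bad primes):
* `cor32_localOrder_of_image` — the `Set.Infinite` / Zhang-congruence shape of the named fact
  `McCallum1991.cor32_eigenclasses_infinite_primes_localOrder` for the given `(N, W, K, p, c, M, cs)`,
  any image with (Z), (S), (C) (bookkeeping of the tree's `…_holds`);
* `cor32_localOrder_of_irreducible_of_unramified` — the same for `E[p]` irreducible, `p` odd, `K`
  imaginary quadratic unramified at `p` and at the bad primes;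
* **`cor32_localOrder_of_irreducible_of_heegner`** — the displayed hypothesis `h32I` of
  `…Thm52AdaptersIrred` / `…Thm52KernelInputsIrred` (p507696/p508713: the fact with the `p`-adic
  tower replaced by `W.HasIrreducibleModPGaloisRep p`) WITH two extra binders held at every use site
  of that chain — `SatisfiesHeegnerHypothesis (W.conductorNorm ℤ) K`, `p ∣ W.conductorNorm ℤ` —
  PROVED (no CM hypothesis used). Without those binders `h32I` is false (dihedral images w.r.t. `K`;
  module docstring of `…CebotarevImage`).

HONEST FRAMING: nothing asserted about any curve; the crux 20165, its stubs and BSD stay open; what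
changed is that the Čebotarev input of the irreducible reading is a kernel theorem.

References: [cite: McCallumLMS1991, §3 Cor. 3.2 (pp. 298–299), §4 (pp. 299–300)]
[cite: Jetchev2008, Lemma 5.1 (p. 821), Rem. 6.2] [cite: Serre1972, §2.6, §5.4]
[cite: WZhang2014, Notations (xii)].
-/

set_option autoImplicit false
-- the Theorems directory repeats the summit name (sibling precedent `KatoDescentPotSupersingularAssembly.lean`)
set_option linter.dupNamespace false

noncomputable section

open scoped Classical Pointwise
open WeierstrassCurve NumberField IsDedekindDomain Field
open Literature.NumberTheory.GaloisRepresentations Literature.NumberTheory.EllipticCurves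

universe u

namespace Summit.BirchSwinnertonDyer.BirchSwinnertonDyer.Theorems.JetchevIrreducibleCebotarev

/-! ### McCallum's Cor. 3.2 in the shape of the named fact: any image with (Z), (S), (C); the irreducible reading -/

/-- **McCallum 1991, Cor. 3.2 at level `p^M` in the shape of the named fact
`McCallum1991.cor32_eigenclasses_infinite_primes_localOrder`, for any image with (Z), (S), (C)** —
infinitely many `ℓ` with `Frob(ℓ) = Frob(∞)` on `K(E_{p^M})`, Zhang's congruence form
`IsKolyvaginPrime N W K p ℓ ∧ M ≤ M(ℓ)`, and `ord c_{i,λ} = p^{N_i}` at the place above `ℓ`; = the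
bookkeeping of the tree's `McCallum1991.cor32_eigenclasses_infinite_primes_localOrder_holds`
((i) above every bound ⟹ infinite; (ii) Frobenius form ⟹ congruence form above `N_E`;
(iii)–(iv) order dictionary) run on `cor32_pow_of_image` instead of the surjective theorem.
[cite: McCallumLMS1991, §3 Cor. 3.2 (pp. 298–299); §4 (pp. 299–300)] [cite: WZhang2014, Notations (xii)] -/
theorem cor32_localOrder_of_image (N : ℕ) [NeZero N] (W : WeierstrassCurve ℚ) [W.IsElliptic]
    [W.IsGloballyMinimal] (K : Type) [Field K] [NumberField K] (hK : IsImaginaryQuadratic K)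
    (p : ℕ) (hp : p.Prime) (hp2 : p ≠ 2)
    (hS : ∀ H : AddSubgroup (geomTorsion (W.baseChange K) p),
      (∀ g : absoluteGaloisGroup K, ∀ t ∈ H, g • t ∈ H) → H = ⊥ ∨ H = ⊤)
    (hCe : ∀ f : geomTorsion (W.baseChange K) p →+ geomTorsion (W.baseChange K) p,
      (∀ (g : absoluteGaloisGroup K) (t : geomTorsion (W.baseChange K) p), f (g • t) = g • f t) →
        ∃ k : ℤ, ∀ t, f t = k • t)
    {z : absoluteGaloisGroup K} {a : ℤ} (ha1 : ¬ (p : ℤ) ∣ a - 1)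
    (hz : ∀ P : geomTorsion (W.baseChange K) p, z • P = a • P)
    (c : K ≃ₐ[ℚ] K) (hc : c ≠ 1) (M : ℕ) (hM : 1 ≤ M)
    (r : ℕ) (cs : Fin r → galH1Torsion (W.baseChange K) ((p ^ M : ℕ) : ℤ))
    (h0 : ∀ i, cs i ≠ 0)
    (hτ : ∀ i, ∃ e : ℤ, (e = 1 ∨ e = -1) ∧ conjAct W c ((p ^ M : ℕ) : ℤ) (cs i) = e • cs i)
    (hind : ∀ b : Fin r → ℤ, ∑ i, b i • cs i = 0 → ∀ i, (addOrderOf (cs i) : ℤ) ∣ b i)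
    (Mi : Fin r → ℕ) (hMi : ∀ i, addOrderOf (cs i) = p ^ Mi i)
    (Nv : Fin r → ℕ) (hNv : ∀ i, Nv i ≤ Mi i) :
    Set.Infinite {ℓ : ℕ | FrobEqFrobInfty W K (p ^ M) ℓ ∧
      Zhang2014.IsKolyvaginPrime N W K p ℓ ∧ M ≤ Zhang2014.kolyvaginIndex W p ℓ ∧
      ∀ i, ∀ v : HeightOneSpectrum (𝓞 K), (ℓ : 𝓞 K) ∈ v.asIdeal →
        ∀ j : ℕ, ((p ^ j : ℕ) : ℤ) • cs i ∈
            (W.baseChange K).torsionLocalKer (v.adicCompletion K) ((p ^ M : ℕ) : ℤ) ↔ Nv i ≤ j} := by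
  haveI : Fact p.Prime := ⟨hp⟩
  have hW : W.exists_weilPairing p := W.exists_weilPairing_holds p
  -- `N_i ≤ M_i` as `p^{N_i - 1} c_i ≠ 0`
  have hN : ∀ i, Nv i ≠ 0 → ((p : ℤ) ^ (Nv i - 1)) • cs i ≠ 0 := by
    intro i hi h
    have hdvd : addOrderOf (cs i) ∣ p ^ (Nv i - 1) := by
      apply addOrderOf_dvd_of_nsmul_eq_zero
      rw [← natCast_zsmul]
      exact_mod_cast h
    rw [hMi i, Nat.pow_dvd_pow_iff_le_right hp.one_lt] at hdvd
    have := hNv i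
    omega
  -- independence in the `a_i c_i = 0` form
  have hind' : ∀ b : Fin r → ℤ, ∑ i, b i • cs i = 0 → ∀ i, b i • cs i = 0 := fun b hb i ↦
    addOrderOf_dvd_iff_zsmul_eq_zero.mp (hind b hb i)
  -- above every bound there is a good prime
  refine Set.infinite_of_forall_exists_gt fun b ↦ ?_
  obtain ⟨ℓ, hbℓ, hKol, hfrob, hloc⟩ :=
    cor32_pow_of_image (W := W) (K := K) (N := N)
      Literature.NumberTheory.Automorphic.chebotarev_artinRep_holds hK hp hp2 hS hCe ha1 hz hW hM hc cs
      h0 Nv hN hτ hind' (max b (W.conductorNorm ℤ))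
  obtain ⟨hℓP, hℓN, hℓD, hℓp, hprime, -⟩ := hKol
  have hbℓ' : b < ℓ := lt_of_le_of_lt (le_max_left _ _) hbℓ
  have hℓNE : ¬ ℓ ∣ W.conductorNorm ℤ := fun h ↦ by
    have := Nat.le_of_dvd (W.conductorNorm_pos_holds) h
    have := lt_of_le_of_lt (le_max_right b _) hbℓ
    omega
  have hidx : M ≤ Zhang2014.kolyvaginIndex W p ℓ :=
    McCallum1991.le_kolyvaginIndex_of_frobEqFrobInfty W K hp hM hℓP hℓp hℓNE hfrob
  refine ⟨ℓ, ⟨hfrob, ⟨hℓP, hℓN, hℓD, hℓp, hprime, lt_of_lt_of_le (by omega) hidx⟩, hidx, ?_⟩, hbℓ'⟩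
  intro i v hv j
  exact McCallum1991.forall_pow_zsmul_mem_iff_of_mem_of_not_mem _ (hloc i v hv).1 (hloc i v hv).2 j



/-- **McCallum 1991, Cor. 3.2 at level `p^M` for `E[p]` IRREDUCIBLE, `K` quadratic unramified at
`p` and at the bad primes** (shape of the named fact
`McCallum1991.cor32_eigenclasses_infinite_primes_localOrder` for the given data): (Z), (S), (C)
from §1–§3, then `cor32_localOrder_of_image`. [cite: McCallumLMS1991, §3 Cor. 3.2]
[cite: Jetchev2008, Lemma 5.1, Rem. 6.2] -/
theorem cor32_localOrder_of_irreducible_of_unramified (N : ℕ) [NeZero N] (W : WeierstrassCurve ℚ)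
    [W.IsElliptic] [W.IsGloballyMinimal] (K : Type) [Field K] [NumberField K]
    (hK : IsImaginaryQuadratic K) (p : ℕ) (hp : p.Prime) (hp2 : p ≠ 2)
    (hirr : W.HasIrreducibleModPGaloisRep p)
    (hv : ∀ v : HeightOneSpectrum (𝓞 ℚ), Algebra.IsUnramifiedIn (𝓞 K) v.asIdeal ∨
      (W.HasGoodReductionAt v ∧ (p : 𝓞 ℚ) ∉ v.asIdeal))
    (c : K ≃ₐ[ℚ] K) (hc : c ≠ 1) (M : ℕ) (hM : 1 ≤ M)
    (r : ℕ) (cs : Fin r → galH1Torsion (W.baseChange K) ((p ^ M : ℕ) : ℤ))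
    (h0 : ∀ i, cs i ≠ 0)
    (hτ : ∀ i, ∃ e : ℤ, (e = 1 ∨ e = -1) ∧ conjAct W c ((p ^ M : ℕ) : ℤ) (cs i) = e • cs i)
    (hind : ∀ b : Fin r → ℤ, ∑ i, b i • cs i = 0 → ∀ i, (addOrderOf (cs i) : ℤ) ∣ b i)
    (Mi : Fin r → ℕ) (hMi : ∀ i, addOrderOf (cs i) = p ^ Mi i)
    (Nv : Fin r → ℕ) (hNv : ∀ i, Nv i ≤ Mi i) :
    Set.Infinite {ℓ : ℕ | FrobEqFrobInfty W K (p ^ M) ℓ ∧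
      Zhang2014.IsKolyvaginPrime N W K p ℓ ∧ M ≤ Zhang2014.kolyvaginIndex W p ℓ ∧
      ∀ i, ∀ v : HeightOneSpectrum (𝓞 K), (ℓ : 𝓞 K) ∈ v.asIdeal →
        ∀ j : ℕ, ((p ^ j : ℕ) : ℤ) • cs i ∈
            (W.baseChange K).torsionLocalKer (v.adicCompletion K) ((p ^ M : ℕ) : ℤ) ↔ Nv i ≤ j} := by
  haveI : Fact p.Prime := ⟨hp⟩
  have hfull := forall_exists_absGaloisRestrict_smul_eq_of_unramified W (K := K) (p := p) hK.1 hv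
  obtain ⟨z, a, ha1, hz⟩ := exists_smul_eq_smul_baseChange_of_irreducible W (K := K) hp2 hirr hfull
  exact cor32_localOrder_of_image N W K hK p hp hp2 (simple_baseChange_of_irreducible W hirr hfull)
    (exists_eq_zsmul_baseChange_of_irreducible W hp2 hirr hfull) ha1 hz c hc M hM r cs h0 hτ hind Mi
    hMi Nv hNv

/-- **The CORRECTED irreducible reading h32I′ of [McC] Cor. 3.2 — a theorem.** The displayed
hypothesis `h32I` of `…Thm52AdaptersIrred` / `…Thm52KernelInputsIrred` (p507696/p508713) — the
named fact `McCallum1991.cor32_eigenclasses_infinite_primes_localOrder` with the `p`-adic tower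
replaced by `W.HasIrreducibleModPGaloisRep p` — with TWO extra binders, both available at every use
site of that chain: `SatisfiesHeegnerHypothesis (W.conductorNorm ℤ) K` and `p ∣ W.conductorNorm ℤ`
(additive `p`). No CM hypothesis is needed (the binder is kept for literalness). Proof: §1 (Heegner
form) + §2 + §3 + `cor32_localOrder_of_image`. [cite: McCallumLMS1991, §3 Cor. 3.2 (p. 299)]
[cite: Jetchev2008, Lemma 5.1 (p. 821), Rem. 6.2] [cite: Serre1972, §2.6, §5.4] -/
theorem cor32_localOrder_of_irreducible_of_heegner (N : ℕ) [NeZero N] (W : WeierstrassCurve ℚ)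
    [W.IsElliptic] [W.IsGloballyMinimal] (_hcm : ¬ W.HasCM) (K : Type) [Field K] [NumberField K]
    (hK : IsImaginaryQuadratic K) (hHg : SatisfiesHeegnerHypothesis (W.conductorNorm ℤ) K)
    (p : ℕ) (hp : p.Prime) (hp2 : p ≠ 2) (hirr : W.HasIrreducibleModPGaloisRep p)
    (hpN : p ∣ W.conductorNorm ℤ)
    (c : K ≃ₐ[ℚ] K) (hc : c ≠ 1) (M : ℕ) (hM : 1 ≤ M)
    (r : ℕ) (cs : Fin r → galH1Torsion (W.baseChange K) ((p ^ M : ℕ) : ℤ))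
    (h0 : ∀ i, cs i ≠ 0)
    (hτ : ∀ i, ∃ e : ℤ, (e = 1 ∨ e = -1) ∧ conjAct W c ((p ^ M : ℕ) : ℤ) (cs i) = e • cs i)
    (hind : ∀ b : Fin r → ℤ, ∑ i, b i • cs i = 0 → ∀ i, (addOrderOf (cs i) : ℤ) ∣ b i)
    (Mi : Fin r → ℕ) (hMi : ∀ i, addOrderOf (cs i) = p ^ Mi i)
    (Nv : Fin r → ℕ) (hNv : ∀ i, Nv i ≤ Mi i) :
    Set.Infinite {ℓ : ℕ | FrobEqFrobInfty W K (p ^ M) ℓ ∧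
      Zhang2014.IsKolyvaginPrime N W K p ℓ ∧ M ≤ Zhang2014.kolyvaginIndex W p ℓ ∧
      ∀ i, ∀ v : HeightOneSpectrum (𝓞 K), (ℓ : 𝓞 K) ∈ v.asIdeal →
        ∀ j : ℕ, ((p ^ j : ℕ) : ℤ) • cs i ∈
            (W.baseChange K).torsionLocalKer (v.adicCompletion K) ((p ^ M : ℕ) : ℤ) ↔ Nv i ≤ j} := by
  haveI : Fact p.Prime := ⟨hp⟩
  have hfull := forall_exists_absGaloisRestrict_smul_eq_of_satisfiesHeegnerHypothesis W (K := K)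
    (p := p) hK hHg hpN
  obtain ⟨z, a, ha1, hz⟩ := exists_smul_eq_smul_baseChange_of_irreducible W (K := K) hp2 hirr hfull
  exact cor32_localOrder_of_image N W K hK p hp hp2 (simple_baseChange_of_irreducible W hirr hfull)
    (exists_eq_zsmul_baseChange_of_irreducible W hp2 hirr hfull) ha1 hz c hc M hM r cs h0 hτ hind Mi
    hMi Nv hNv

end Summit.BirchSwinnertonDyer.BirchSwinnertonDyer.Theorems.JetchevIrreducibleCebotarev

end
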